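import Mathlib
import Summits.HubbardSuperconductivity.HubbardSuperconductivity.Theorems.BalabanIRBirGappedPhaseReductionRBlockLondonStripTrig

/-!
# Route BalabanIR — crux 4R `BirGappedPhaseReductionR` (item `stmt-HubbardSuperconductivity-14846`):
# block-London coercivity VI — the pointwise Fermi-strip estimate

THEOREM (`strip_pointwise`).  Near a base point `b` of the Fermi curve of the `d+id` BdG reference
with equal `|sin bᵢ| = S > 0` (signs `σᵢ`) and local gap `D = |Δ(b)|`, inside the box
`|kᵢ - bᵢ| ≤ ρ` (`16ρ ≤ S`, `(2|Δ₁|+4|Δ₂|)·4ρ ≤ D/10`) and on the strip `1/2 ≤ ξ(k)/|Δ(k)| ≤ 2`, a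
small displacement `v` (`|vᵢ| ≤ ρ`, `|vᵢ| ≤ D/40`) whose chord vector `uᵢ = 2 sin(vᵢ/2)` is
"normal enough" (`|uᵢ| ≤ |σ₀u₀ + σ₁u₁|`) changes the anomalous amplitude `f = Δ/E` by at least
  `S |σ₀u₀ + σ₁u₁| / (572 D) ≤ |f(k) - f(k+v)|`,
provided the gap is small on the Fermi-velocity scale, `2|Δ₁| + 4|Δ₂| ≤ S/22`.
PROOF. `|f| = φ(ξ/|Δ|)` with `φ(t) = (1+t²)^{-1/2}` (`norm_symbol_eq_phi`); the ratio
`t = ξ/|Δ|` moves by `(ξ(k+v)-ξ(k))/|Δ(k+v)| + ξ(k)(|Δ(k)|-|Δ(k+v)|)/(|Δ(k)||Δ(k+v)|)`, whose first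
term is `≥ S|σ·u|/(1.1 D)` (`xiC_sub_lower`) and whose second is `≤` half of that (Lipschitz bound
`deltaC_sub_norm_le`, Jordan's inequality and the smallness of the gap), while the total shift is
`≤ 1/4`, so both ratios stay in `[1/4, 3]` where `φ` is bi-Lipschitz from below (`phi_sub_ge`).
This is the pointwise half of hypothesis (K1) (stiffness) of the kernel symbol inequality; no
definition is introduced.
-/

noncomputable section

namespace Summit.HubbardSuperconductivity.HubbardSuperconductivity.Theorems

namespace BirBdG

/-- `|φ t - φ t'| ≥ |t - t'|/260` on `[1/4, 3]`, symmetric form of `phi_sub_ge`. [folklore] -/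
theorem abs_phi_sub_ge {t t' : ℝ} (ht : 1 / 4 ≤ t) (ht3 : t ≤ 3) (ht' : 1 / 4 ≤ t') (ht'3 : t' ≤ 3) :
    |t - t'| / 260 ≤ |1 / Real.sqrt (1 + t ^ 2) - 1 / Real.sqrt (1 + t' ^ 2)| := by
  rcases le_total t t' with h | h
  · have := phi_sub_ge ht ht'3 h
    rw [abs_sub_comm t t', abs_of_nonneg (sub_nonneg.2 h)]
    exact this.trans (le_abs_self _)
  · have := phi_sub_ge ht' ht3 h
    rw [abs_of_nonneg (sub_nonneg.2 h), abs_sub_comm]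
    exact this.trans (le_abs_self _)

/-- Part (1) of the strip estimate: on the box the gap amplitude stays within `10%` of its base
value, and it is Lipschitz along the displacement. [folklore] -/
theorem strip_amplitude (Δ₁ Δ₂ D ρ : ℝ) (b k v : Fin 2 → ℝ)
    (Δc : (Fin 2 → ℝ) → ℂ)
    (hΔc : ∀ p, Δc p = ((2 * Δ₁ * (Real.cos (p 0) - Real.cos (p 1)) : ℝ) : ℂ) -
      4 * Complex.I * ((Δ₂ * Real.sin (p 0) * Real.sin (p 1) : ℝ) : ℂ))
    (hD : ‖Δc b‖ = D) (hρD : (2 * |Δ₁| + 4 * |Δ₂|) * (4 * ρ) ≤ D / 10)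
    (hk : ∀ i, |k i - b i| ≤ ρ) (hvρ : ∀ i, |v i| ≤ ρ) :
    (D - D / 20 ≤ ‖Δc k‖ ∧ ‖Δc k‖ ≤ D + D / 20) ∧
      (D - D / 10 ≤ ‖Δc (k + v)‖ ∧ ‖Δc (k + v)‖ ≤ D + D / 10) ∧
      |‖Δc k‖ - ‖Δc (k + v)‖| ≤ (2 * |Δ₁| + 4 * |Δ₂|) * (2 * max |v 0| |v 1|) := by
  set C : ℝ := 2 * |Δ₁| + 4 * |Δ₂| with hC
  set η : ℝ := max |v 0| |v 1| with hη
  have hvη : ∀ i, |v i| ≤ η := fun i => by fin_cases i <;> simp [hη]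
  have hLipk : ‖Δc k - Δc b‖ ≤ D / 20 := by
    rw [hΔc, hΔc]
    refine (deltaC_sub_norm_le Δ₁ Δ₂ b k).trans ?_
    calc (2 * |Δ₁| + 4 * |Δ₂|) * (|k 0 - b 0| + |k 1 - b 1|) ≤ C * (ρ + ρ) := by
          rw [← hC]; gcongr; exacts [hk 0, hk 1]
      _ = (C * (4 * ρ)) / 2 := by ring
      _ ≤ (D / 10) / 2 := by gcongr
      _ = D / 20 := by ring
  have hLipkv : ‖Δc (k + v) - Δc b‖ ≤ D / 10 := by
    rw [hΔc, hΔc]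
    refine (deltaC_sub_norm_le Δ₁ Δ₂ b (k + v)).trans ?_
    have e : ∀ i, |(k + v) i - b i| ≤ 2 * ρ := fun i => by
      rw [Pi.add_apply, show k i + v i - b i = (k i - b i) + v i by ring]
      exact (abs_add_le _ _).trans (by linarith [hk i, hvρ i])
    calc (2 * |Δ₁| + 4 * |Δ₂|) * (|(k + v) 0 - b 0| + |(k + v) 1 - b 1|) ≤ C * (2 * ρ + 2 * ρ) := by
          rw [← hC]; gcongr; exacts [e 0, e 1]
      _ = C * (4 * ρ) := by ring
      _ ≤ D / 10 := hρD
  have hLipv : ‖Δc (k + v) - Δc k‖ ≤ C * (2 * η) := by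
    rw [hΔc, hΔc]
    refine (deltaC_sub_norm_le Δ₁ Δ₂ k (k + v)).trans ?_
    have e : ∀ i, |(k + v) i - k i| ≤ η := fun i => by
      rw [Pi.add_apply, add_sub_cancel_left]; exact hvη i
    calc (2 * |Δ₁| + 4 * |Δ₂|) * (|(k + v) 0 - k 0| + |(k + v) 1 - k 1|) ≤ C * (η + η) := by
          rw [← hC]; gcongr; exacts [e 0, e 1]
      _ = C * (2 * η) := by ring
  refine ⟨⟨?_, ?_⟩, ⟨?_, ?_⟩, ?_⟩
  · have := norm_sub_norm_le (Δc b) (Δc k)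
    rw [hD, norm_sub_rev] at this
    linarith
  · have := norm_sub_norm_le (Δc k) (Δc b)
    rw [hD] at this
    linarith
  · have := norm_sub_norm_le (Δc b) (Δc (k + v))
    rw [hD, norm_sub_rev] at this
    linarith
  · have := norm_sub_norm_le (Δc (k + v)) (Δc b)
    rw [hD] at this
    linarith
  · rw [abs_sub_comm]
    exact (abs_norm_sub_norm_le (Δc (k + v)) (Δc k)).trans hLipv

/-- Parts (2)–(3) of the strip estimate: the ratio `t = ξ/|Δ|` is shifted by at least
`S|σ·u|/(2.2 D)` and by at most `1/4`. [folklore] -/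
theorem strip_shift (μ Δ₁ Δ₂ S D ρ : ℝ) (σ b k v : Fin 2 → ℝ)
    (ξc : (Fin 2 → ℝ) → ℝ) (hξc : ∀ p, ξc p = -2 * Real.cos (p 0) - 2 * Real.cos (p 1) - μ)
    (Δc : (Fin 2 → ℝ) → ℂ)
    (hΔc : ∀ p, Δc p = ((2 * Δ₁ * (Real.cos (p 0) - Real.cos (p 1)) : ℝ) : ℂ) -
      4 * Complex.I * ((Δ₂ * Real.sin (p 0) * Real.sin (p 1) : ℝ) : ℂ))
    (hσ : ∀ i, σ i = 1 ∨ σ i = -1) (hS : ∀ i, σ i * Real.sin (b i) = S) (hSpos : 0 < S)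
    (hρ : 0 < ρ) (h16ρ : 16 * ρ ≤ S) (hD : ‖Δc b‖ = D) (hDpos : 0 < D)
    (hρD : (2 * |Δ₁| + 4 * |Δ₂|) * (4 * ρ) ≤ D / 10) (hsmall : 2 * |Δ₁| + 4 * |Δ₂| ≤ S / 22)
    (hk : ∀ i, |k i - b i| ≤ ρ) (ht : 1 / 2 ≤ ξc k / ‖Δc k‖ ∧ ξc k / ‖Δc k‖ ≤ 2)
    (hvρ : ∀ i, |v i| ≤ ρ) (hvD : ∀ i, |v i| ≤ D / 40)
    (hw : ∀ i, |2 * Real.sin (v i / 2)| ≤ |σ 0 * (2 * Real.sin (v 0 / 2)) + σ 1 * (2 * Real.sin (v 1 / 2))|) :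
    S * |σ 0 * (2 * Real.sin (v 0 / 2)) + σ 1 * (2 * Real.sin (v 1 / 2))| / (11 / 5 * D) ≤
        |ξc (k + v) / ‖Δc (k + v)‖ - ξc k / ‖Δc k‖| ∧
      (1 / 4 ≤ ξc (k + v) / ‖Δc (k + v)‖ ∧ ξc (k + v) / ‖Δc (k + v)‖ ≤ 3) ∧
      0 < ‖Δc k‖ ∧ 0 < ‖Δc (k + v)‖ := by
  obtain ⟨⟨ha1l, ha1u⟩, ⟨ha2l, ha2u⟩, ha12⟩ := strip_amplitude Δ₁ Δ₂ D ρ b k v Δc hΔc hD hρD hk hvρ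
  -- abbreviations
  set C : ℝ := 2 * |Δ₁| + 4 * |Δ₂| with hC
  set w : ℝ := σ 0 * (2 * Real.sin (v 0 / 2)) + σ 1 * (2 * Real.sin (v 1 / 2)) with hw_def
  set u0 : ℝ := 2 * Real.sin (v 0 / 2) with hu0
  set u1 : ℝ := 2 * Real.sin (v 1 / 2) with hu1
  set η : ℝ := max |v 0| |v 1| with hη
  set a1 : ℝ := ‖Δc k‖ with ha1
  set a2 : ℝ := ‖Δc (k + v)‖ with ha2
  have hC0 : 0 ≤ C := by positivity
  have hη0 : 0 ≤ η := le_max_of_le_left (abs_nonneg _)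
  have hvη : ∀ i, |v i| ≤ η := fun i => by fin_cases i <;> simp [hη]
  have hηρ : η ≤ ρ := max_le (hvρ 0) (hvρ 1)
  have hηD : η ≤ D / 40 := max_le (hvD 0) (hvD 1)
  have ha1pos : 0 < a1 := by linarith
  have ha2pos : 0 < a2 := by linarith
  -- (2) the hopping increment
  have hA : ∀ i, |σ i * Real.sin (k i + v i / 2) - S| ≤ 2 * ρ := by
    intro i
    rw [← hS i, ← mul_sub]
    have hσabs : |σ i| = 1 := by rcases hσ i with h | h <;> simp [h]
    rw [abs_mul, hσabs, one_mul]
    refine (Real.abs_sin_sub_sin_le _ _).trans ?_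
    rw [show k i + v i / 2 - b i = (k i - b i) + v i / 2 by ring]
    refine (abs_add_le _ _).trans ?_
    have : |v i / 2| = |v i| / 2 := by rw [abs_div, abs_two]
    linarith [hk i, hvρ i]
  have hξlow := xiC_sub_lower μ S ρ σ hσ k v hA
  have hξup := xiC_sub_upper μ k v
  set ξ1 : ℝ := ξc k with hξ1
  set ξ2 : ℝ := ξc (k + v) with hξ2
  have hdξ : ξ2 - ξ1 = (-2 * Real.cos ((k + v) 0) - 2 * Real.cos ((k + v) 1) - μ) -
      (-2 * Real.cos (k 0) - 2 * Real.cos (k 1) - μ) := by rw [hξ2, hξ1, hξc, hξc]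
  rw [← hdξ] at hξlow hξup
  -- chords versus `η`
  have hu0η : |u0| ≤ η := (two_sin_half_abs_le (v 0)).trans (hvη 0)
  have hu1η : |u1| ≤ η := (two_sin_half_abs_le (v 1)).trans (hvη 1)
  have hw0 : |u0| ≤ |w| := hw 0
  have hw1 : |u1| ≤ |w| := hw 1
  -- Jordan: `|w| ≥ (2/π) η`
  have hS1 : S ≤ 1 := by
    have := hS 0
    rcases hσ 0 with h | h
    · rw [h, one_mul] at this; rw [← this]; exact Real.sin_le_one _
    · rw [h] at this; rw [← this]; have := Real.neg_one_le_sin (b 0); linarith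
  have hvπ : ∀ i, |v i| ≤ Real.pi := fun i => by
    linarith [hvρ i, Real.pi_gt_three]
  have hwη : 2 / Real.pi * η ≤ |w| := by
    rcases le_total |v 0| |v 1| with h | h
    · rw [show η = |v 1| from max_eq_right h]
      exact (abs_le_two_sin_half (hvπ 1)).trans hw1
    · rw [show η = |v 0| from max_eq_left h]
      exact (abs_le_two_sin_half (hvπ 0)).trans hw0
  have hwη' : η ≤ 2 * |w| := by
    have : η ≤ Real.pi / 2 * |w| := by
      have h2 := mul_le_mul_of_nonneg_left hwη (by positivity : (0 : ℝ) ≤ Real.pi / 2)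
      rw [← mul_assoc, show Real.pi / 2 * (2 / Real.pi) = 1 by field_simp, one_mul] at h2
      exact h2
    have h3 : Real.pi / 2 * |w| ≤ 2 * |w| :=
      mul_le_mul_of_nonneg_right (by linarith [Real.pi_lt_four]) (abs_nonneg w)
    linarith
  -- the increment bounds in terms of `|w|` and `η`
  have hξlow' : 2 * S * |w| - 8 * ρ * η ≤ |ξ2 - ξ1| := by
    have p0 := mul_le_mul_of_nonneg_left hu0η (by positivity : (0 : ℝ) ≤ 4 * ρ)
    have p1 := mul_le_mul_of_nonneg_left hu1η (by positivity : (0 : ℝ) ≤ 4 * ρ)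
    linarith
  have hξup' : |ξ2 - ξ1| ≤ 4 * η := by linarith
  -- (3) the two ratios
  set t1 : ℝ := ξ1 / a1 with ht1
  set t2 : ℝ := ξ2 / a2 with ht2
  have ht1' : 1 / 2 ≤ t1 ∧ t1 ≤ 2 := ht
  have hξ1b : |ξ1| ≤ 2 * a1 := by
    have : |t1| ≤ 2 := abs_le.2 ⟨by linarith [ht1'.1], ht1'.2⟩
    rw [ht1, abs_div, abs_of_pos ha1pos, div_le_iff₀ ha1pos] at this
    linarith
  have hsplit : t2 - t1 = (ξ2 - ξ1) / a2 + ξ1 * (a1 - a2) / (a1 * a2) := by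
    rw [ht1, ht2]; field_simp; ring
  have hsecond : |ξ1 * (a1 - a2) / (a1 * a2)| ≤ 2 * (C * (2 * η)) / a2 := by
    rw [abs_div, abs_mul, abs_of_pos (mul_pos ha1pos ha2pos)]
    rw [div_le_div_iff₀ (mul_pos ha1pos ha2pos) ha2pos]
    have h1 : |ξ1| * |a1 - a2| ≤ 2 * a1 * (C * (2 * η)) :=
      mul_le_mul hξ1b ha12 (abs_nonneg _) (by positivity)
    have h2 := mul_le_mul_of_nonneg_right h1 ha2pos.le
    linarith
  have hfirst_up : |(ξ2 - ξ1) / a2| ≤ 4 * η / a2 := by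
    rw [abs_div, abs_of_pos ha2pos]; gcongr
  have hfirst_low : (2 * S * |w| - 8 * ρ * η) / a2 ≤ |(ξ2 - ξ1) / a2| := by
    rw [abs_div, abs_of_pos ha2pos]; gcongr
  -- total shift `≤ 1/4`
  have hCη : C * η ≤ D / 40 := by
    have : C * η ≤ C * ρ := mul_le_mul_of_nonneg_left hηρ hC0
    linarith
  have hshift : |t2 - t1| ≤ 1 / 4 := by
    rw [hsplit]
    refine (abs_add_le _ _).trans ?_
    have h1 : 4 * η / a2 ≤ 1 / 8 := by
      rw [div_le_iff₀ ha2pos]; linarith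
    have h2 : 2 * (C * (2 * η)) / a2 ≤ 1 / 9 := by
      rw [div_le_iff₀ ha2pos]; linarith
    linarith [hfirst_up, hsecond]
  have ht2' : 1 / 4 ≤ t2 ∧ t2 ≤ 3 := by
    have := abs_le.1 hshift
    constructor <;> linarith [ht1'.1, ht1'.2]
  -- lower bound on the shift: first term dominates
  have hlow : S * |w| / (11 / 5 * D) ≤ |t2 - t1| := by
    rw [hsplit]
    have hrev : |(ξ2 - ξ1) / a2| - |ξ1 * (a1 - a2) / (a1 * a2)| ≤
        |(ξ2 - ξ1) / a2 + ξ1 * (a1 - a2) / (a1 * a2)| := by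
      have := abs_sub_abs_le_abs_sub ((ξ2 - ξ1) / a2) (-(ξ1 * (a1 - a2) / (a1 * a2)))
      rwa [abs_neg, sub_neg_eq_add] at this
    have hf : S * |w| / (11 / 10 * D) ≤ (2 * S * |w| - 8 * ρ * η) / a2 := by
      rw [div_le_div_iff₀ (by positivity) ha2pos]
      have h1 : 8 * ρ * η ≤ S * |w| := by
        have p := mul_le_mul_of_nonneg_left hwη' (by positivity : (0 : ℝ) ≤ 8 * ρ)
        have q := mul_le_mul_of_nonneg_right h16ρ (abs_nonneg w)
        linarith
      have h2 : S * |w| * a2 ≤ S * |w| * (11 / 10 * D) := by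
        apply mul_le_mul_of_nonneg_left _ (by positivity); linarith
      have h3 : S * |w| ≤ 2 * S * |w| - 8 * ρ * η := by linarith
      have h4 := mul_le_mul_of_nonneg_right h3 (by positivity : (0 : ℝ) ≤ 11 / 10 * D)
      linarith
    have hs : 2 * (C * (2 * η)) / a2 ≤ S * |w| / (22 / 10 * D) := by
      rw [div_le_div_iff₀ ha2pos (by positivity)]
      have h1 : C * η ≤ S / 22 * (2 * |w|) := by
        calc C * η ≤ S / 22 * η := by gcongr
          _ ≤ S / 22 * (2 * |w|) := by gcongr
      have h2 : S * |w| * (9 / 10 * D) ≤ S * |w| * a2 := by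
        apply mul_le_mul_of_nonneg_left _ (by positivity); linarith
      have p := mul_le_mul_of_nonneg_right h1 (by positivity : (0 : ℝ) ≤ 4 * (22 / 10 * D))
      have hSwD : 0 ≤ S * |w| * D := by positivity
      linarith
    have key : S * |w| / (11 / 5 * D) = S * |w| / (11 / 10 * D) - S * |w| / (22 / 10 * D) := by
      field_simp; ring
    rw [key]
    linarith [hfirst_low, hsecond]
  exact ⟨hlow, ht2', ha1pos, ha2pos⟩

/-- **The pointwise Fermi-strip estimate.** See the module docstring. [folklore] -/
theorem strip_pointwise : ∀ (μ Δ₁ Δ₂ S D ρ : ℝ) (σ b k v : Fin 2 → ℝ) (ξc : (Fin 2 → ℝ) → ℝ) (Δc : (Fin 2 → ℝ) → ℂ) (fc : (Fin 2 → ℝ) → ℂ), (∀ p, ξc p = -2 * Real.cos (p 0) - 2 * Real.cos (p 1) - μ) → (∀ p, Δc p = ((2 * Δ₁ * (Real.cos (p 0) - Real.cos (p 1)) : ℝ) : ℂ) - 4 * Complex.I * ((Δ₂ * Real.sin (p 0) * Real.sin (p 1) : ℝ) : ℂ)) → (∀ p, fc p = Δc p / ((Real.sqrt (ξc p ^ 2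 + ‖Δc p‖ ^ 2) : ℝ) : ℂ)) → (∀ i, σ i = 1 ∨ σ i = -1) → (∀ i, σ i * Real.sin (b i) = S) → 0 < S → 0 < ρ → 16 * ρ ≤ S → ‖Δc b‖ = D → 0 < D → (2 * |Δ₁| + 4 * |Δ₂|) * (4 * ρ) ≤ D / 10 → 2 * |Δ₁| + 4 * |Δ₂| ≤ S / 22 → (∀ i, |k i - b i| ≤ ρ) → (1 / 2 ≤ ξc k / ‖Δc k‖ ∧ ξc k / ‖Δc k‖ ≤ 2) → (∀ i, |v i| ≤ ρ) → (∀ i, |v i| ≤ D / 40) → (∀ i, |2 * Real.sin (v i / 2)| ≤ |σ 0 * (2 * Real.sin (v 0 / 2)) + σ 1 * (2 * Real.sin (v 1 / 2))|) → S * |σ 0 * (2 * Real.sin (v 0 / 2)) + σ 1 * (2 * Real.sin (v 1 / 2))| / (572 * D) ≤ ‖fc k - fc (k + v)‖ := by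
  intro μ Δ₁ Δ₂ S D ρ σ b k v ξc Δc fc hξc hΔc hfc hσ hS hSpos hρ h16ρ hD hDpos hρD hsmall hk ht hvρ hvD hw
  obtain ⟨hlow, ht2', ha1pos, ha2pos⟩ := strip_shift μ Δ₁ Δ₂ S D ρ σ b k v ξc hξc Δc hΔc hσ hS hSpos
    hρ h16ρ hD hDpos hρD hsmall hk ht hvρ hvD hw
  set w : ℝ := σ 0 * (2 * Real.sin (v 0 / 2)) + σ 1 * (2 * Real.sin (v 1 / 2)) with hw_def
  set t1 : ℝ := ξc k / ‖Δc k‖ with ht1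
  set t2 : ℝ := ξc (k + v) / ‖Δc (k + v)‖ with ht2
  have ht1' : 1 / 2 ≤ t1 ∧ t1 ≤ 2 := ht
  have hD1 : Δc k ≠ 0 := fun h => by rw [h, norm_zero] at ha1pos; exact lt_irrefl _ ha1pos
  have hD2 : Δc (k + v) ≠ 0 := fun h => by rw [h, norm_zero] at ha2pos; exact lt_irrefl _ ha2pos
  have hn1 : ‖fc k‖ = 1 / Real.sqrt (1 + t1 ^ 2) := by
    rw [hfc, norm_symbol_eq_phi (ξc k) (Δc k) hD1]
  have hn2 : ‖fc (k + v)‖ = 1 / Real.sqrt (1 + t2 ^ 2) := by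
    rw [hfc, norm_symbol_eq_phi (ξc (k + v)) (Δc (k + v)) hD2]
  have hphi := abs_phi_sub_ge (t := t1) (t' := t2) (by linarith [ht1'.1]) (by linarith [ht1'.2])
    ht2'.1 ht2'.2
  rw [← hn1, ← hn2] at hphi
  have hnn : |‖fc k‖ - ‖fc (k + v)‖| ≤ ‖fc k - fc (k + v)‖ := abs_norm_sub_norm_le _ _
  have hchain : S * |w| / (572 * D) ≤ |t1 - t2| / 260 := by
    rw [abs_sub_comm]
    rw [div_le_div_iff₀ (by positivity) (by norm_num)]
    have := hlow
    rw [div_le_iff₀ (by positivity)] at this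
    have p := mul_le_mul_of_nonneg_left this (by norm_num : (0 : ℝ) ≤ 260)
    linarith
  exact hchain.trans (hphi.trans hnn)

end BirBdG

end Summit.HubbardSuperconductivity.HubbardSuperconductivity.Theorems

end
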